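import Summits.CriticalPhenomena.PercolationContinuityZ3.Theorems.PercNearOneGluingNoHeavyLowerTailSahiLCExmaxRefutation
import Mathlib
import HarnessLib
import HarnessLib.Audit.Tags

/-!
# `NoHeavyLowerTail` (crux stmt-CriticalPhenomena-4575), master-family line P1 (gen 20):
# the VERTEX PRINCIPLE for exchangeable coordinate weights — an inequality that holds at every VERTEX weight (every pure/twisted fibre
# of every section) holds at ALL nonnegative exchangeable weights

Support file (seat `prim-masterthm-p1`, gen 20; `--supports stmt-CriticalPhenomena-4575`), on top of `…SahiLCExmaxRefutation` (gen 18: `tripleWeightInt`,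
`wRainbowSumInt`, `wSideSumInt`).  Memo `run/shared/lean/prim/prim-masterthm/FROM-prim-masterthm-p1-g20-ORBLOCK-AND-CERTIFICATES.md` §2.

THE POINT.  Every weighted functional of this line has the shape `L(w) = Σ_{x,y,z ⊆ S} (Π_{j∈S} w_j(#{x,y,z ∋ j})) · h(x,y,z)` (`wTriple`); it is LINEAR in each coordinate's
weight vector `(w_j(0), …, w_j(3))` separately (`wTriple_expand`).  Hence (`wTriple_nonneg_of_vertices`): **if `L ≥ 0` at every VERTEX weight** (each `w_j` one of the
indicator vectors `δ₀, δ₁, δ₂, δ₃` — these are exactly gen 16–19's fibre values: `δ₀` = coordinate deleted, `δ₁` pure, `δ₂` twisted, `δ₃` contracted) **then `L ≥ 0` at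
every coordinatewise NONNEGATIVE exchangeable weight** — in particular at the i.i.d. weights `(q³, q²p, qp², p³)` of a product measure, where `T, Φ_A, Φ_B` are the measure
aggregates `6e₃, 6κG, 6oG` (gen 16 dictionary).  Equivalently: the vertex values ARE the tensor-Bernstein coefficients of `L` along the moment curve, and this is the
Bernstein certificate of nonnegativity.  Corollaries stated here: CP3⁺ at all vertex fibres of `f` ⟹ `T ≤ Φ_A + Φ_B` at all nonnegative weights
(`cp3plus_weights_of_vertices`; at i.i.d. weights this is S₃⁺ `(κ+o)G ≥ e₃` for `f`), and the ONE-PAYER VERTEX CERTIFICATE (`corePays_weights_of_vertices`,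
`outsidePays_weights_of_vertices`: a payer that suffices at every vertex fibre suffices at every nonnegative weight, in particular S₃^max holds for such "uniform"
systems at every bias).  The seat's exhaustive census (gen 20, kit j216232) found CP3⁺ at all `4^5` vertices of all 49 861 021 sunflower labelings of `2^5` and classified
them as 6 283 195 both-uniform / 4 862 535 core-uniform / 4 862 535 outside-uniform / 5 113 185 mixed; the mixed ones need the LP certificates of the memo (§4).
HONEST FRAMING: an elementary multilinearity argument, formalized; no conjecture of the line is settled by it. [this work]
-/

namespace Summit.CriticalPhenomena.PercolationContinuityZ3.Theorems

namespace SahiPivotFamily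

open Finset AntipodalStrongHarris AntipodalStrongHarris.Lab

/-! ### 1. The general weighted triple functional and its linearity in one coordinate's weight vector -/

/-- The general exchangeable-weight functional `Σ_{x,y,z ⊆ S} (Π_j w_j #{x,y,z ∋ j}) · h x y z`. [this work] -/
def wTriple (S : Finset ℕ) (wz : ℕ → ℕ → ℤ) (h : Finset ℕ → Finset ℕ → Finset ℕ → ℤ) : ℤ :=
  ∑ x ∈ S.powerset, ∑ y ∈ S.powerset, ∑ z ∈ S.powerset, tripleWeightInt S wz x y z * h x y z

/-- The vertex (indicator) weight vector `δ_c`. [this work] -/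
def vtx (c : ℕ) : ℕ → ℤ := fun c' => if c' = c then 1 else 0

/-- Vertex weights are nonnegative. [this work] -/
theorem vtx_nonneg (c c' : ℕ) : 0 ≤ vtx c c' := by
  unfold vtx; split_ifs <;> norm_num

/-- The per-coordinate count `#{x,y,z ∋ j}` is at most `3`. [this work] -/
theorem count_lt_four (x y z : Finset ℕ) (j : ℕ) :
    (if j ∈ x then 1 else 0) + (if j ∈ y then 1 else 0) + (if j ∈ z then 1 else 0) < 4 := by
  split_ifs <;> omega

/-- Replacing coordinate `j`'s weight vector by the vertex `δ_c` picks out the indicator of "count at `j` equals `c`". [this work] -/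
theorem tripleWeightInt_update_vtx (S : Finset ℕ) {j : ℕ} (hj : j ∈ S) (wz : ℕ → ℕ → ℤ) (c : ℕ) (x y z : Finset ℕ) :
    tripleWeightInt S (Function.update wz j (vtx c)) x y z =
      (if (if j ∈ x then 1 else 0) + (if j ∈ y then 1 else 0) + (if j ∈ z then 1 else 0) = c then 1 else 0) *
        ∏ i ∈ S.erase j, wz i ((if i ∈ x then 1 else 0) + (if i ∈ y then 1 else 0) + (if i ∈ z then 1 else 0)) := by
  unfold tripleWeightInt
  rw [← mul_prod_erase S _ hj, Function.update_self]
  congr 1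
  exact prod_congr rfl fun i hi => by rw [Function.update_of_ne (ne_of_mem_erase hi)]

/-- **Linearity in coordinate `j`**: `L(w) = Σ_{c<4} w_j(c) · L(w[j ↦ δ_c])`. [this work] -/
theorem wTriple_expand (S : Finset ℕ) {j : ℕ} (hj : j ∈ S) (wz : ℕ → ℕ → ℤ) (h : Finset ℕ → Finset ℕ → Finset ℕ → ℤ) :
    wTriple S wz h = ∑ c ∈ range 4, wz j c * wTriple S (Function.update wz j (vtx c)) h := by
  unfold wTriple
  simp only [mul_sum]
  conv_rhs => rw [Finset.sum_comm]
  refine sum_congr rfl fun x _ => ?_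
  conv_rhs => rw [Finset.sum_comm]
  refine sum_congr rfl fun y _ => ?_
  conv_rhs => rw [Finset.sum_comm]
  refine sum_congr rfl fun z _ => ?_
  -- pointwise: tw(wz) * h = Σ_c wz j c * (tw(update) * h)
  simp only [tripleWeightInt_update_vtx S hj]
  set n := (if j ∈ x then 1 else 0) + (if j ∈ y then 1 else 0) + (if j ∈ z then 1 else 0) with hn
  set P := ∏ i ∈ S.erase j, wz i ((if i ∈ x then 1 else 0) + (if i ∈ y then 1 else 0) + (if i ∈ z then 1 else 0)) with hP
  have htw : tripleWeightInt S wz x y z = wz j n * P := by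
    unfold tripleWeightInt; rw [← mul_prod_erase S _ hj]
  rw [htw]
  have hmem : n ∈ range 4 := mem_range.mpr (count_lt_four x y z j)
  have : ∑ c ∈ range 4, wz j c * ((if n = c then 1 else 0) * P * h x y z) =
      ∑ c ∈ range 4, (if n = c then wz j n * P * h x y z else 0) := by
    refine sum_congr rfl fun c _ => ?_
    split_ifs with hc
    · subst hc; ring
    · ring
  rw [this, sum_ite_eq, if_pos hmem]

/-! ### 2. The vertex principle -/

/-- **THE VERTEX PRINCIPLE.**  If `L(δ) ≥ 0` for every vertex weight `δ` (each coordinate of `S` carrying one of `δ₀,…,δ₃`), then `L(w) ≥ 0` for every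
coordinatewise nonnegative weight `w` (induction on the number of non-vertex coordinates, by `wTriple_expand`). [this work] -/
theorem wTriple_nonneg_of_vertices (S : Finset ℕ) (h : Finset ℕ → Finset ℕ → Finset ℕ → ℤ)
    (H : ∀ δ : ℕ → ℕ → ℤ, (∀ j ∈ S, ∃ c, c < 4 ∧ δ j = vtx c) → 0 ≤ wTriple S δ h)
    (wz : ℕ → ℕ → ℤ) (hw : ∀ j ∈ S, ∀ c, 0 ≤ wz j c) : 0 ≤ wTriple S wz h := by
  -- claim: for every `T`, every nonnegative weight that is a vertex outside `T` gives `L ≥ 0`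
  suffices key : ∀ T : Finset ℕ, ∀ w : ℕ → ℕ → ℤ, (∀ j ∈ S, ∀ c, 0 ≤ w j c) →
      (∀ j ∈ S, j ∉ T → ∃ c, c < 4 ∧ w j = vtx c) → 0 ≤ wTriple S w h by
    exact key S wz hw (fun j hj hjS => (hjS hj).elim)
  intro T
  induction T using Finset.induction_on with
  | empty => exact fun w _ hv => H w fun j hj => hv j hj (by simp)
  | insert j T hjT ih =>
    intro w hw0 hv
    by_cases hjS : j ∈ S
    · rw [wTriple_expand S hjS w h]
      refine sum_nonneg fun c hc => mul_nonneg (hw0 j hjS c) (ih _ ?_ ?_)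
      · intro i hi c'
        by_cases hij : i = j
        · subst hij; rw [Function.update_self]; exact vtx_nonneg _ _
        · rw [Function.update_of_ne hij]; exact hw0 i hi c'
      · intro i hi hiT
        by_cases hij : i = j
        · subst hij; exact ⟨c, mem_range.mp hc, Function.update_self _ _ _⟩
        · rw [Function.update_of_ne hij]
          exact hv i hi (by rw [mem_insert, not_or]; exact ⟨hij, hiT⟩)
    · exact ih w hw0 fun i hi hiT => hv i hi (by rw [mem_insert, not_or]; exact ⟨fun h' => hjS (h' ▸ hi), hiT⟩)

/-! ### 3. The line's functionals as instances; corollaries -/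

variable {k : ℕ}

/-- `T` is a `wTriple`. [this work] -/
theorem wRainbowSumInt_eq_wTriple (S : Finset ℕ) (wz : ℕ → ℕ → ℤ) (f : Finset ℕ → Lab k) :
    wRainbowSumInt S wz f = wTriple S wz (fun x y z => rainbow (f x) (f y) (f z)) := rfl

/-- `Φ_a` is a `wTriple`. [this work] -/
theorem wSideSumInt_eq_wTriple (S : Finset ℕ) (wz : ℕ → ℕ → ℤ) (f : Finset ℕ → Lab k) (a : Lab k) :
    wSideSumInt S wz f a = wTriple S wz (fun x y z => if f x = a then 3 * kappa (f y) (f z) else 0) := by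
  unfold wSideSumInt wTriple
  refine sum_congr rfl fun x _ => sum_congr rfl fun y _ => sum_congr rfl fun z _ => ?_
  beta_reduce
  by_cases hx : f x = a
  · rw [if_pos hx, if_pos hx]
  · rw [if_neg hx, if_neg hx, mul_zero]

/-- `wTriple` is linear in `h`: differences. [this work] -/
theorem wTriple_sub (S : Finset ℕ) (wz : ℕ → ℕ → ℤ) (h₁ h₂ : Finset ℕ → Finset ℕ → Finset ℕ → ℤ) :
    wTriple S wz (fun x y z => h₁ x y z - h₂ x y z) = wTriple S wz h₁ - wTriple S wz h₂ := by
  unfold wTriple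
  simp only [mul_sub, sum_sub_distrib]

/-- `wTriple` is linear in `h`: sums. [this work] -/
theorem wTriple_add (S : Finset ℕ) (wz : ℕ → ℕ → ℤ) (h₁ h₂ : Finset ℕ → Finset ℕ → Finset ℕ → ℤ) :
    wTriple S wz (fun x y z => h₁ x y z + h₂ x y z) = wTriple S wz h₁ + wTriple S wz h₂ := by
  unfold wTriple
  simp only [mul_add, sum_add_distrib]

/-- **CP3⁺ at all vertex fibres ⟹ CP3⁺ at all nonnegative exchangeable weights** (`T ≤ Φ_A + Φ_B`); at the i.i.d. weights of a product measure this is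
S₃⁺ `(κ+o)·G ≥ e₃` for the system `f`. [this work] -/
theorem cp3plus_weights_of_vertices (S : Finset ℕ) (f : Finset ℕ → Lab k)
    (H : ∀ δ : ℕ → ℕ → ℤ, (∀ j ∈ S, ∃ c, c < 4 ∧ δ j = vtx c) →
      wRainbowSumInt S δ f ≤ wSideSumInt S δ f top + wSideSumInt S δ f bot)
    (wz : ℕ → ℕ → ℤ) (hw : ∀ j ∈ S, ∀ c, 0 ≤ wz j c) :
    wRainbowSumInt S wz f ≤ wSideSumInt S wz f top + wSideSumInt S wz f bot := by
  have key := wTriple_nonneg_of_vertices S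
    (fun x y z => ((if f x = top then 3 * kappa (f y) (f z) else 0) + (if f x = bot then 3 * kappa (f y) (f z) else 0))
      - rainbow (f x) (f y) (f z)) (fun δ hδ => by
        have := H δ hδ
        rw [wTriple_sub, wTriple_add, ← wSideSumInt_eq_wTriple, ← wSideSumInt_eq_wTriple, ← wRainbowSumInt_eq_wTriple]
        linarith) wz hw
  rw [wTriple_sub, wTriple_add, ← wSideSumInt_eq_wTriple, ← wSideSumInt_eq_wTriple, ← wRainbowSumInt_eq_wTriple] at key
  linarith

/-- **One-payer vertex certificate (core)**: if the core pays at every vertex fibre (`T ≤ Φ_A` at every vertex weight) then it pays at every nonnegative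
exchangeable weight — in particular `e₃ ≤ κ·G` (hence S₃^max) for `f` at every product measure. [this work] -/
theorem corePays_weights_of_vertices (S : Finset ℕ) (f : Finset ℕ → Lab k)
    (H : ∀ δ : ℕ → ℕ → ℤ, (∀ j ∈ S, ∃ c, c < 4 ∧ δ j = vtx c) → wRainbowSumInt S δ f ≤ wSideSumInt S δ f top)
    (wz : ℕ → ℕ → ℤ) (hw : ∀ j ∈ S, ∀ c, 0 ≤ wz j c) :
    wRainbowSumInt S wz f ≤ wSideSumInt S wz f top := by
  have key := wTriple_nonneg_of_vertices S
    (fun x y z => (if f x = top then 3 * kappa (f y) (f z) else 0) - rainbow (f x) (f y) (f z)) (fun δ hδ => by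
        have := H δ hδ
        rw [wTriple_sub, ← wSideSumInt_eq_wTriple, ← wRainbowSumInt_eq_wTriple]
        linarith) wz hw
  rw [wTriple_sub, ← wSideSumInt_eq_wTriple, ← wRainbowSumInt_eq_wTriple] at key
  linarith

/-- **One-payer vertex certificate (outside)**: the same with the outside payer `Φ_B`. [this work] -/
theorem outsidePays_weights_of_vertices (S : Finset ℕ) (f : Finset ℕ → Lab k)
    (H : ∀ δ : ℕ → ℕ → ℤ, (∀ j ∈ S, ∃ c, c < 4 ∧ δ j = vtx c) → wRainbowSumInt S δ f ≤ wSideSumInt S δ f bot)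
    (wz : ℕ → ℕ → ℤ) (hw : ∀ j ∈ S, ∀ c, 0 ≤ wz j c) :
    wRainbowSumInt S wz f ≤ wSideSumInt S wz f bot := by
  have key := wTriple_nonneg_of_vertices S
    (fun x y z => (if f x = bot then 3 * kappa (f y) (f z) else 0) - rainbow (f x) (f y) (f z)) (fun δ hδ => by
        have := H δ hδ
        rw [wTriple_sub, ← wSideSumInt_eq_wTriple, ← wRainbowSumInt_eq_wTriple]
        linarith) wz hw
  rw [wTriple_sub, ← wSideSumInt_eq_wTriple, ← wRainbowSumInt_eq_wTriple] at key
  linarith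

/-! ### 4. The typed all-vertex CP3⁺ and its kernel links -/

/-- **CONJECTURE (CP3⁺ at every vertex fibre; typed).**  For every `k`, every finite `S ⊆ ℕ`, every sunflower labeling `f` and every VERTEX weight `δ`
(each coordinate deleted / pure / twisted / contracted): `T ≤ Φ_A + Φ_B`.  This is gen 13's comb conjecture CP3⁺ on ALL fibres (pure and twisted) of all sections;
the seat's census (gen 20, kit j216232) verifies it for every labeling of `2^m`, `m ≤ 5` (all `4^m` vertices; 0 violations) and on 6.9·10⁶ random systems of
`2^6 … 2^8`.  By the vertex principle it implies CP3⁺ at ALL nonnegative exchangeable weights (`cp3plus_allWeights_of_vertexCP3Plus`), in particular S₃⁺ for every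
system at every product measure (gen 16 dictionary), and it contains `PurePatternCP3Plus` (`purePatternCP3Plus_of_vertexCP3Plus`). [this work] [status: open] -/
@[conjecture] def VertexCP3Plus (k : ℕ) : Prop :=
  ∀ (S : Finset ℕ) (f : Finset ℕ → Lab k) (δ : ℕ → ℕ → ℤ), (∀ ⦃X Y : Finset ℕ⦄, X ⊆ Y → f X ≤ f Y) →
    (∀ j ∈ S, ∃ c, c < 4 ∧ δ j = vtx c) → wRainbowSumInt S δ f ≤ wSideSumInt S δ f top + wSideSumInt S δ f bot

/-- **Kernel link: all-vertex CP3⁺ ⟹ CP3⁺ at every nonnegative exchangeable weight.** [this work] -/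
theorem cp3plus_allWeights_of_vertexCP3Plus (hV : VertexCP3Plus k) (S : Finset ℕ) (f : Finset ℕ → Lab k)
    (hf : ∀ ⦃X Y : Finset ℕ⦄, X ⊆ Y → f X ≤ f Y) (wz : ℕ → ℕ → ℤ) (hw : ∀ j ∈ S, ∀ c, 0 ≤ wz j c) :
    wRainbowSumInt S wz f ≤ wSideSumInt S wz f top + wSideSumInt S wz f bot :=
  cp3plus_weights_of_vertices S f (fun δ hδ => hV S f δ hf hδ) wz hw

/-- The pure weight of the tree (`pureWt`, real) is the cast of the vertex weight `δ₁`. [this work] -/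
theorem pureWt_eq_cast_vtx : (fun (_ : ℕ) (c : ℕ) => ((vtx 1 c : ℤ) : ℝ)) = fun _ => pureWt := by
  funext j c
  simp only [vtx, pureWt]
  split_ifs <;> simp

/-- **Kernel link: all-vertex CP3⁺ contains CP3⁺ at pure patterns** (the all-`δ₁` vertex). [this work] -/
theorem purePatternCP3Plus_of_vertexCP3Plus (hV : VertexCP3Plus k) : PurePatternCP3Plus k := by
  intro S f hf
  rw [pivotSum_self_nonneg_iff]
  have h := hV S f (fun _ => vtx 1) hf (fun j _ => ⟨1, by norm_num, rfl⟩)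
  have hR : (rainbowSum S f : ℝ) = (wRainbowSumInt S (fun _ => vtx 1) f : ℝ) := by
    rw [← wRainbowSum_pure, ← wRainbowSum_intCast, pureWt_eq_cast_vtx]
  have hS : ∀ a : Lab k, (sideSum S f a : ℝ) = (wSideSumInt S (fun _ => vtx 1) f a : ℝ) := by
    intro a
    rw [← wSideSum_pure, ← wSideSum_intCast, pureWt_eq_cast_vtx]
  have h' : (wRainbowSumInt S (fun _ => vtx 1) f : ℝ) ≤
      (wSideSumInt S (fun _ => vtx 1) f top : ℝ) + (wSideSumInt S (fun _ => vtx 1) f bot : ℝ) := by exact_mod_cast h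
  rw [← hR, ← hS, ← hS] at h'
  exact_mod_cast h'

end SahiPivotFamily

end Summit.CriticalPhenomena.PercolationContinuityZ3.Theorems
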